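import Summits.Ventures.HodgeRepro2.T5SU11LegendreSeriesDeriv

/-!
# The energy Parseval identity: `∫_{−1}^{1} (1 − x²) f′² = Σ_k k(k + 1) · 2 c_k(f)²/(2k + 1)`

For a `C⁴` function `f` on `[−1, 1]` (hypotheses `h₁`–`h₄`, `h₄c` as in rows 425–427) the termwise differentiation
of row 426, `f′ = Σ_k c_k(f) P′_k` with the summable majorant `|c_k(f)| k(k + 1)/2`, integrated against
`(1 − x²) f′` by dominated convergence, and the first integration by parts of row 422,
`∫ (1 − x²) f′ P′_k = k(k + 1) ∫ f P_k = k(k + 1) · 2 c_k(f)/(2k + 1)`, give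

  **`∫_{−1}^{1} (1 − x²) f′(x)² dx = Σ_k k(k + 1) · 2 c_k(f)²/(2k + 1)`**   (`hasSum_energy`, `integral_energy_eq_tsum`):

Parseval's identity for the Dirichlet energy of the Legendre expansion (the eigenvalues `k(k + 1)` of the
Sturm–Liouville operator weight the Parseval sum of row 420). Consequences: the energy is bounded below by every
partial sum (`sum_energy_le`), the coefficient decay `k(k + 1) · 2 c_k(f)²/(2k + 1) ≤ ∫ (1 − x²) f′²`
(`energy_term_le`), and `c_k(f)² ≤ (2k + 1) ∫ (1 − x²) f′² / (2k(k + 1))` (`sq_fourierLegendre_le_energy`).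
Nothing is claimed about (N).

Blind lane: Mathlib + the HodgeRepro2 prefix only; no sorry; axioms ⊆ {propext, Classical.choice,
Quot.sound}.
-/

namespace Summit.Ventures.HodgeRepro2.T5SU11LegendreEnergyParseval

open Polynomial intervalIntegral Finset Filter Topology MeasureTheory
open Set (Icc Ioc Ioo uIcc uIoc EqOn)
open T5SU11SphericalLegendreAll T5SU11LegendreIdentities T5SU11LegendreOrthogonal T5SU11LegendreBound
  T5SU11LegendreSeries T5SU11LegendreCoefficientDecay T5SU11LegendreSeriesUniform T5SU11LegendreSeriesRate
  T5SU11LegendreSeriesDeriv T5SU11LegendreDerivativeSum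

section C4

variable {f f₁ f₂ f₃ f₄ : ℝ → ℝ}
  (h₁ : ∀ x ∈ Icc (-1 : ℝ) 1, HasDerivAt f (f₁ x) x)
  (h₂ : ∀ x ∈ Icc (-1 : ℝ) 1, HasDerivAt f₁ (f₂ x) x)
  (h₃ : ∀ x ∈ Icc (-1 : ℝ) 1, HasDerivAt f₂ (f₃ x) x)
  (h₄ : ∀ x ∈ Icc (-1 : ℝ) 1, HasDerivAt f₃ (f₄ x) x)
  (h₄c : ContinuousOn f₄ (Icc (-1 : ℝ) 1))
include h₁ h₂ h₃ h₄ h₄c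

omit h₁ h₃ h₄ h₄c in
/-- `f′` is bounded on `[−1, 1]` (it is continuous there). -/
theorem exists_bound_deriv : ∃ C, ∀ x ∈ Icc (-1 : ℝ) 1, |f₁ x| ≤ C := by
  have hc : ContinuousOn f₁ (Icc (-1 : ℝ) 1) := fun x hx => (h₂ x hx).continuousAt.continuousWithinAt
  obtain ⟨C, hC⟩ := (isCompact_Icc.image_of_continuousOn hc).isBounded.exists_norm_le
  exact ⟨C, fun x hx => by simpa [Real.norm_eq_abs] using hC (f₁ x) ⟨x, hx, rfl⟩⟩

/-- **Termwise integration of the energy**: `∫ (1 − x²) f′² = Σ_k c_k(f) ∫ (1 − x²) f′ P′_k` (dominated convergence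
with the majorant `|c_k(f)| k(k + 1)/2 · sup |f′|`). -/
theorem hasSum_integral_energy_term :
    HasSum (fun k => fourierLegendre f k * ∫ x in (-1 : ℝ)..1, (1 - x ^ 2) * f₁ x * legQ k x)
      (∫ x in (-1 : ℝ)..1, (1 - x ^ 2) * f₁ x ^ 2) := by
  obtain ⟨C, hC⟩ := exists_bound_deriv h₂
  have hC0 : 0 ≤ C := (abs_nonneg _).trans (hC 0 (by norm_num))
  have hc₁ : ContinuousOn f₁ (Icc (-1 : ℝ) 1) := fun x hx => (h₂ x hx).continuousAt.continuousWithinAt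
  have hmaj := (summable_abs_fourierLegendre_mul_deriv_bound h₁ h₂ h₃ h₄ h₄c).mul_right C
  have hsub : uIoc (-1 : ℝ) 1 ⊆ Icc (-1 : ℝ) 1 := by
    rw [Set.uIoc_of_le (by norm_num)]
    exact Set.Ioc_subset_Icc_self
  have hmeas : ∀ k, AEStronglyMeasurable (fun t => fourierLegendre f k * legQ k t * ((1 - t ^ 2) * f₁ t))
      (volume.restrict (uIoc (-1 : ℝ) 1)) := fun k => by
    have hcont : ContinuousOn (fun t => fourierLegendre f k * legQ k t * ((1 - t ^ 2) * f₁ t)) (Icc (-1 : ℝ) 1) :=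
      (continuous_const.mul (continuous_legQ k)).continuousOn.mul
        ((continuous_const.sub (continuous_pow 2)).continuousOn.mul hc₁)
    exact (hcont.mono hsub).aestronglyMeasurable measurableSet_uIoc
  have hbound : ∀ k, ∀ᵐ t ∂volume, t ∈ uIoc (-1 : ℝ) 1 →
      ‖fourierLegendre f k * legQ k t * ((1 - t ^ 2) * f₁ t)‖
        ≤ |fourierLegendre f k| * ((k : ℝ) * (k + 1) / 2) * C := fun k =>
    Filter.Eventually.of_forall fun t ht => by
      have ht' : t ∈ Icc (-1 : ℝ) 1 := hsub ht
      rw [Real.norm_eq_abs, abs_mul, abs_mul, abs_mul]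
      have h1 : |1 - t ^ 2| ≤ 1 := by
        rw [abs_le]
        constructor <;> nlinarith [ht'.1, ht'.2]
      calc |fourierLegendre f k| * |legQ k t| * (|1 - t ^ 2| * |f₁ t|)
          ≤ |fourierLegendre f k| * ((k : ℝ) * (k + 1) / 2) * (1 * C) := by
            gcongr
            · exact abs_legQ_le k ht'
            · exact hC t ht'
        _ = |fourierLegendre f k| * ((k : ℝ) * (k + 1) / 2) * C := by rw [one_mul]
  have hlim : ∀ᵐ t ∂volume, t ∈ uIoc (-1 : ℝ) 1 →
      HasSum (fun k => fourierLegendre f k * legQ k t * ((1 - t ^ 2) * f₁ t)) (f₁ t * ((1 - t ^ 2) * f₁ t)) :=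
    Filter.Eventually.of_forall fun t ht =>
      (hasSum_fourierLegendre_mul_legQ h₁ h₂ h₃ h₄ h₄c (hsub ht)).mul_right _
  have h := intervalIntegral.hasSum_integral_of_dominated_convergence (μ := volume) (a := (-1 : ℝ)) (b := 1)
    (fun k _ => |fourierLegendre f k| * ((k : ℝ) * (k + 1) / 2) * C) hmeas hbound
    (Filter.Eventually.of_forall fun _ _ => hmaj) intervalIntegrable_const hlim
  have hI : ∫ t in (-1 : ℝ)..1, f₁ t * ((1 - t ^ 2) * f₁ t) = ∫ x in (-1 : ℝ)..1, (1 - x ^ 2) * f₁ x ^ 2 :=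
    integral_congr fun x _ => by ring
  rw [← hI]
  refine h.congr_fun fun k => ?_
  rw [← intervalIntegral.integral_const_mul]
  exact integral_congr fun x _ => by ring

/-- **THE ENERGY PARSEVAL IDENTITY**: `Σ_k k(k + 1) · 2 c_k(f)²/(2k + 1) = ∫_{−1}^{1} (1 − x²) f′²`. -/
theorem hasSum_energy :
    HasSum (fun k : ℕ => (k : ℝ) * ((k : ℝ) + 1) * (fourierLegendre f k ^ 2 * (2 / (2 * (k : ℝ) + 1))))
      (∫ x in (-1 : ℝ)..1, (1 - x ^ 2) * f₁ x ^ 2) := by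
  refine (hasSum_integral_energy_term h₁ h₂ h₃ h₄ h₄c).congr_fun fun k => ?_
  -- `∫ (1 − x²) f′ P′_k = k(k + 1) ∫ f P_k` (row 422's first integration by parts)
  have e := integral_mul_legP_eq_integral_deriv h₁ h₂ k
  rw [← e, fourierLegendre]
  have hne : (2 * (k : ℝ) + 1) ≠ 0 := by positivity
  field_simp

/-- `∫_{−1}^{1} (1 − x²) f′² = Σ_k k(k + 1) · 2 c_k(f)²/(2k + 1)` as a `tsum`. -/
theorem integral_energy_eq_tsum :
    ∫ x in (-1 : ℝ)..1, (1 - x ^ 2) * f₁ x ^ 2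
      = ∑' k : ℕ, (k : ℝ) * ((k : ℝ) + 1) * (fourierLegendre f k ^ 2 * (2 / (2 * (k : ℝ) + 1))) :=
  (hasSum_energy h₁ h₂ h₃ h₄ h₄c).tsum_eq.symm

/-- Every partial sum of the energy series is at most the energy (the terms are non-negative). -/
theorem sum_energy_le (n : ℕ) :
    ∑ k ∈ range n, ((k : ℕ) : ℝ) * ((k : ℝ) + 1) * (fourierLegendre f k ^ 2 * (2 / (2 * (k : ℝ) + 1)))
      ≤ ∫ x in (-1 : ℝ)..1, (1 - x ^ 2) * f₁ x ^ 2 :=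
  sum_le_hasSum (range n) (fun (k : ℕ) _ => by positivity) (hasSum_energy h₁ h₂ h₃ h₄ h₄c)

/-- Each term of the energy series is at most the energy: `k(k + 1) · 2 c_k(f)²/(2k + 1) ≤ ∫ (1 − x²) f′²`. -/
theorem energy_term_le (k : ℕ) :
    (k : ℝ) * ((k : ℝ) + 1) * (fourierLegendre f k ^ 2 * (2 / (2 * (k : ℝ) + 1)))
      ≤ ∫ x in (-1 : ℝ)..1, (1 - x ^ 2) * f₁ x ^ 2 :=
  le_hasSum (hasSum_energy h₁ h₂ h₃ h₄ h₄c) k fun (j : ℕ) _ => by positivity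

/-- **The coefficient bound from the energy**: `c_k(f)² ≤ (2k + 1) ∫ (1 − x²) f′² / (2k(k + 1))` (`k ≥ 1`). -/
theorem sq_fourierLegendre_le_energy {k : ℕ} (hk : 1 ≤ k) :
    fourierLegendre f k ^ 2
      ≤ (2 * (k : ℝ) + 1) * (∫ x in (-1 : ℝ)..1, (1 - x ^ 2) * f₁ x ^ 2) / (2 * ((k : ℝ) * ((k : ℝ) + 1))) := by
  have hk' : (1 : ℝ) ≤ (k : ℝ) := by exact_mod_cast hk
  have h := energy_term_le h₁ h₂ h₃ h₄ h₄c k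
  rw [le_div_iff₀ (by positivity)]
  have hne : (2 * (k : ℝ) + 1) ≠ 0 := by positivity
  have e : (k : ℝ) * ((k : ℝ) + 1) * (fourierLegendre f k ^ 2 * (2 / (2 * (k : ℝ) + 1)))
      = fourierLegendre f k ^ 2 * (2 * ((k : ℝ) * ((k : ℝ) + 1))) / (2 * (k : ℝ) + 1) := by
    field_simp
  rw [e, div_le_iff₀ (by positivity)] at h
  linarith

end C4

end Summit.Ventures.HodgeRepro2.T5SU11LegendreEnergyParseval
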